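import Summits.QuantumFields.BalabanUV.T4Continuum.Support.SliceFlatGradient
import Summits.QuantumFields.BalabanUV.T4Continuum.Support.SliceFlatStencil
import Literature.MathematicalPhysics.QuantumFieldTheory.Balaban1983to89.B5G110BlockRowSum

/-!
# T⁴ programme, NE2 (U1a) sub-row Δ3 (`T4-U1a.S-NE2-D3-WALK°`) — [B5] (1.110) SECOND ENTRY `∇G` AT `U = 1` IN THE
# n-UNIFORM EXPONENTIALLY WEIGHTED ROW-SUM CURRENCY ON BAŁABAN's FINE TORUS, TRANSPORTED FROM THE NE3 LINEAGE's FLAT RUNG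

NE2 formalisation swarm `b2b-balaban-t4-ne2-formalise-*`, leaf prover 05 (gen 6); supplier item «NE2-Δ3-GRAD-TRANSPORT» (INTENT
CLAIMS.log 2026-08-20T14:56Z) under the row owner's sub-row Δ3.  Gen 5 of this seat (`Support/SmallCouplingEntryDecayRel`, p220908)
left `hdec` for FIRST-ORDER perturbations waiting on «weighted row sums of `∇𝒢^{(k)}` — not in the tree».  They ARE in the tree, on
the NE3 carrier: the NE3 prover lineage (t4-ne3-p1 gen 15) proved in `Support/SliceFlatGradient` (p203576)
`cubeSum_rowDiff_gFlat_le : ∃ B₁ δ > 0, ∀ k N L, j ≤ k, ν, p, y₁, Σ_{q ∈ Δ_j(y₁)} |gFlat j (p+e_ν) q − gFlat j p q| ≤ B₁·L^j·e^{−δ·nbd_j}`,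
where `gFlat j p q = (L^{min(j,k)})²·Re (DeltaA (side k L j) (Mlev d k N L j) 1)⁻¹ (eF p) (eF q)` (`Support/SliceFlatPropagator`) IS
pv15's `G = Δ_1⁻¹` ([B5] (1.71)–(1.73), `B5DeltaA169.DeltaA`) read through the value-preserving reindexing
`SliceFlatPropagator.eF : (ℤ/NL^k)^{d+1} ≃ Tor (fine (side k L j) (Mlev d k N L j))`.  THIS FILE is the DICTIONARY + TRANSPORT
back to Bałaban's fine torus and into the weighted `ℓ^∞ → ℓ^∞` currency of pv15's `B5G110BlockRowSum.weighted_row_sum_le'`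
(the currency gen 5's `hdec_pertCovC_small_rel` consumes):
 * §1 `shiftM_mul_apply`, `fdiff_mul_apply` (`(∇_ν·A)(i,j) = n(A((i₁+e_ν,i₂),j) − A(i,j))`), `norm_fdiff_DeltaA_inv_apply` (realness of
   `Δ_a⁻¹`, pv15's `B5RealFields.isReal_DeltaA_inv`), **`abs_rowDiff_gFlat_eq`**: `|rowDiff ν (gFlat j) p q| = L^{min(j,k)}·‖(∇_ν·Δ_1⁻¹)(eF p, eF q)‖`;
 * §2 `blockOf_eF` (NE3's cube map IS pv15's block map), `circAbs_le_pabs`, **`torusSupNorm_rep_sub_rep_le_nbd`** (pv15's ℓ^∞ torus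
   block distance `≤` NE3's ℓ¹ block distance);
 * §3 **`block_row_sum_fdiff_inv_le`**: from ANY constants `(B₁, δ ≥ 0)` satisfying NE3's row statement, for `j ≤ k`, every direction `ν`,
   every row `i` and every block `y′` of `Tor (fine (side k L j) (Mlev d k N L j))`:
   `Σ_{x′ ∈ B(y′)} ‖(∇_ν·Δ_1⁻¹)(i,x′)‖ ≤ B₁·e^{−δ·|blk(i) − y′|_{T₁,∞}}` — UNIFORM in the lattice spacing;
 * §4 **`weighted_row_sum_fdiff_inv_le`**: for `δ′ < δ`, `Σ_{x′} e^{δ′|blk(i) − blk(x′)|_{T₁,∞}}‖(∇_ν·Δ_1⁻¹)(i,x′)‖ ≤ B₁·K_{d+1}(δ − δ′)`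
   (`K = B4Sect5Proof.latticeConst`; pv15's block swap `B5G110BlockRowSum.sum_blockOf_mul` + the uniform torus sum
   `B5Hk163TorusHolderRate.sum_exp_torusSupNorm_sub_rep_le`);
 * §5 **`weighted_row_sum_fdiff_inv_le_cubic`**: the packaged form `∃ B δ > 0` (functions of `d`) for EVERY `n ≥ 1` and EVERY CUBIC unit
   torus `fun _ => N₀` (witness `(k,N,L,j) = (1,N₀,n,1)`), with NE3's constants.

HONEST FRAMING (T4-DAG p. 1).  Bookkeeping only: the analysis is t4-ne3-p1's (heat-kernel free gradient + resolvent identity around the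
free operator + gen 14's (3.49) entry bound) and pv15's ((1.110) first entry, block resummation); nothing of either is restated.  `U = 1`,
`a = 1`; CUBIC unit tori only (the NE3 carrier has one period for all directions); the SECOND entry `∇G` (row sums) only — the third
entry `G∇*` in ROW-sum form is a COLUMN sum of `∇G` and is NOT supplied by NE3's row statement; constants NE3's existential `B₁, δ`;
MODEL level (not tier B's `balabanPert`); nothing printed asserted — [B5] p.35 (1.110) is a TEXT LOCATION; sub-row Δ3 NOT closed for
Bałaban's carrier; nothing of NE3's node (the wall (W1) `U ≠ 1` untouched); **NE2 (U1a) NOT PROVED**; spine PROVED 0/9; NOT infinite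
volume, NOT a mass gap, NOT Clay.  HONEST DEPENDENCY: continuum YM on T⁴ ⇐ BetaPertH ∧ nine spine estimates (0/9 proved); BetaPertH ⇐
(D1) ∧ (D4) ∧ CAP+tail; G-an2-4 gates asym, D1 and NE2/3/4.  ABSOLUTE RULE kept; no `def`; no `sorry`.
-/

noncomputable section

open scoped BigOperators ComplexConjugate Matrix
open Finset

namespace Summit.QuantumFields.BalabanUV.T4Continuum.GradientRowSumTransport

open Literature.MathematicalPhysics.QuantumFieldTheory.Balaban1983to89.TreeLengthTorus (TPt)
open Literature.MathematicalPhysics.QuantumFieldTheory.Balaban1983to89.B5Prop11Plancherel (Tor fine unitVec shiftM fdiff)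
open Literature.MathematicalPhysics.QuantumFieldTheory.Balaban1983to89.B5Block118 (bpt)
open Literature.MathematicalPhysics.QuantumFieldTheory.Balaban1983to89.B5Blocks16 (blockOf blockOf_bpt)
open Literature.MathematicalPhysics.QuantumFieldTheory.Balaban1983to89.B5G115SupBound (exists_eq_bpt_blockOf)
open Literature.MathematicalPhysics.QuantumFieldTheory.Balaban1983to89.B6LowerBound2153Torus (rep)
open Literature.MathematicalPhysics.QuantumFieldTheory.Balaban1983to89.B5DeltaA169 (DeltaA)
open Literature.MathematicalPhysics.QuantumFieldTheory.Balaban1983to89.B5RealFields (isReal_DeltaA_inv)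
open Literature.MathematicalPhysics.QuantumFieldTheory.Balaban1983to89.B4TorusKernel.MultiPeriod (circAbs circAbs_le_abs
  circAbs_add_mul circAbs_nonneg torusSupNorm torusSupNorm_nonneg)
open Literature.MathematicalPhysics.QuantumFieldTheory.Balaban1983to89.B4Sect5Proof (latticeConst latticeConst_nonneg)
open Literature.MathematicalPhysics.QuantumFieldTheory.Balaban1983to89.B5Hk163TorusHolderRate (sum_exp_torusSupNorm_sub_rep_le)
open Literature.MathematicalPhysics.QuantumFieldTheory.Balaban1983to89.B5G110BlockRowSum (sum_blockOf_mul)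
open Literature.MathematicalPhysics.QuantumFieldTheory.Balaban1983to89.B12Decay510Torus (pabs pabs_nonneg pl1_eq_sum)
open Summit.QuantumFields.BalabanUV.T4Continuum
open SliceTorusBlocks SliceTorusTower SliceCovariantTower SliceFlatPropagator SliceFlatFreeResolvent SliceFlatGradient

variable {d : ℕ}

/-! ## §1 Entries of `∇_ν·A`; realness of `Δ_a⁻¹`; NE3's row difference of `gFlat` IS `L^{min(j,k)}·(∇_ν·Δ_1⁻¹)` read through `eF` -/

section Dictionary

variable (Nf : Fin d → ℕ) [∀ μ, NeZero (Nf μ)]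

/-- `(S_ν·A)(i,j) = A((i₁+e_ν,i₂),j)`. [folklore] -/
theorem shiftM_mul_apply {ι : Type*} (ν : Fin d) (A : Matrix (Tor Nf × Fin d) ι ℂ) (i : Tor Nf × Fin d) (j : ι) :
    (shiftM Nf ν * A) i j = A (i.1 + unitVec Nf ν, i.2) j := by
  rw [Matrix.mul_apply, Finset.sum_eq_single (i.1 + unitVec Nf ν, i.2)]
  · simp [shiftM]
  · intro m _ hm
    simp [shiftM, hm]
  · intro h; exact absurd (Finset.mem_univ _) h

/-- **`(∇_ν·A)(i,j) = c·(A((i₁+e_ν,i₂),j) − A(i,j))`**: left multiplication by the forward difference differences the ROW index.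
[folklore] -/
theorem fdiff_mul_apply {ι : Type*} (c : ℂ) (ν : Fin d) (A : Matrix (Tor Nf × Fin d) ι ℂ) (i : Tor Nf × Fin d) (j : ι) :
    (fdiff Nf c ν * A) i j = c * (A (i.1 + unitVec Nf ν, i.2) j - A i j) := by
  rw [fdiff, Matrix.smul_mul, Matrix.sub_mul, Matrix.one_mul, Matrix.smul_apply, Matrix.sub_apply, shiftM_mul_apply,
    smul_eq_mul]

variable (n : ℕ) [NeZero n] (M : Fin d → ℕ) [∀ μ, NeZero (M μ)]

/-- the entries of `∇_ν·Δ_a⁻¹` are `n·|Re G((i₁+e_ν,i₂),j) − Re G(i,j)|` in modulus (`G = Δ_a⁻¹` is a REAL matrix, pv15's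
`B5RealFields.isReal_DeltaA_inv`). [folklore] -/
theorem norm_fdiff_DeltaA_inv_apply (a : ℝ) (ν : Fin d) (i j : Tor (fine n M) × Fin d) :
    ‖(fdiff (fine n M) (n : ℂ) ν * (DeltaA n M a)⁻¹) i j‖
      = (n : ℝ) * |((DeltaA n M a)⁻¹ (i.1 + unitVec (fine n M) ν, i.2) j).re - ((DeltaA n M a)⁻¹ i j).re| := by
  rw [fdiff_mul_apply]
  have h1 := (isReal_DeltaA_inv n M a).im_eq_zero (i.1 + unitVec (fine n M) ν, i.2) j
  have h2 := (isReal_DeltaA_inv n M a).im_eq_zero i j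
  have e : (DeltaA n M a)⁻¹ (i.1 + unitVec (fine n M) ν, i.2) j - (DeltaA n M a)⁻¹ i j
      = ((((DeltaA n M a)⁻¹ (i.1 + unitVec (fine n M) ν, i.2) j).re - ((DeltaA n M a)⁻¹ i j).re : ℝ) : ℂ) := by
    apply Complex.ext
    · simp
    · simp [h1, h2]
  rw [e, norm_mul, Complex.norm_natCast, Complex.norm_real, Real.norm_eq_abs]

end Dictionary

section Flat

variable (d k N L : ℕ) [NeZero N] [NeZero L]

/-- **NE3's ROW DIFFERENCE OF `gFlat j` IS `L^{min(j,k)}·(∇_ν·Δ_1⁻¹)` READ THROUGH `eF`**: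
`|rowDiff ν (gFlat j) p q| = L^{min(j,k)}·‖(∇_ν·(DeltaA (side k L j) (Mlev d k N L j) 1)⁻¹)((eF p₁,p₂),(eF q₁,q₂))‖`. [folklore] -/
theorem abs_rowDiff_gFlat_eq (j : ℕ) (ν : Fin (d + 1)) (p q : TPt (d + 1) (N * L ^ k) × Fin (d + 1)) :
    |rowDiff d k N L ν (gFlat d k N L j) p q|
      = (side k L j : ℝ) * ‖(fdiff (fine (side k L j) (Mlev d k N L j)) (side k L j : ℂ) ν
          * (DeltaA (side k L j) (Mlev d k N L j) 1)⁻¹) (eF d k N L j p.1, p.2) (eF d k N L j q.1, q.2)‖ := by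
  rw [norm_fdiff_DeltaA_inv_apply]
  simp only [rowDiff, gFlat]
  rw [SliceFlatStencil.eF_add, SliceFlatStencil.eF_single, ← mul_sub, abs_mul,
    abs_of_nonneg (by positivity : (0 : ℝ) ≤ (side k L j : ℝ) ^ 2)]
  ring

/-! ## §2 Blocks and distances: NE3's cube map and ℓ¹ block distance against pv15's block map and ℓ^∞ torus distance -/

/-- **NE3's cube map IS pv15's block map** through `eF`: `blockOf (eF z) = cube j z`. [folklore] -/
theorem blockOf_eF (j : ℕ) (z : TPt (d + 1) (N * L ^ k)) :
    blockOf (side k L j) (Mlev d k N L j) (eF d k N L j z) = cube (d + 1) k N L j z := by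
  obtain ⟨r, hr⟩ := (cube_eq_iff_exists_bpt d k N L j z (cube (d + 1) k N L j z)).mp rfl
  rw [hr, blockOf_bpt]

omit [NeZero N] [NeZero L] in
/-- the circular distance of an integer to `Tℤ` is at most the modulus of the centred representative of its class. [folklore] -/
theorem circAbs_le_pabs {T : ℕ} [NeZero T] (t : ℤ) : circAbs T t ≤ pabs (t : ZMod T) := by
  have hT : 1 ≤ T := Nat.one_le_iff_ne_zero.mpr (NeZero.ne T)
  have h : (((t : ZMod T).valMinAbs : ℤ) : ZMod T) = (t : ZMod T) := ZMod.coe_valMinAbs _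
  obtain ⟨m, hm⟩ := (ZMod.intCast_eq_intCast_iff_dvd_sub _ _ _).mp h
  have ht : t = (t : ZMod T).valMinAbs + (T : ℤ) * m := by linarith
  calc circAbs T t = circAbs T ((t : ZMod T).valMinAbs + (T : ℤ) * m) := by rw [← ht]
    _ = circAbs T (t : ZMod T).valMinAbs := circAbs_add_mul _ _ _
    _ ≤ |((t : ZMod T).valMinAbs : ℤ)| := circAbs_le_abs hT _
    _ = pabs (t : ZMod T) := rfl

/-- **pv15's ℓ^∞ torus block distance `≤` NE3's ℓ¹ block distance**: `|rep y − rep y₁|_{T₁,∞} ≤ nbd_j(y, y₁)`. [folklore] -/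
theorem torusSupNorm_rep_sub_rep_le_nbd (j : ℕ) (y y₁ : TPt (d + 1) (levM k N L j)) :
    torusSupNorm (Mlev d k N L j) (rep (Mlev d k N L j) y - rep (Mlev d k N L j) y₁) ≤ (nbd (d + 1) k N L j y y₁ : ℝ) := by
  have hcast : (nbd (d + 1) k N L j y y₁ : ℝ) = ∑ μ, (pabs ((y - y₁) μ) : ℝ) := by
    unfold nbd; rw [cast_npl1, pl1_eq_sum]
  rw [hcast]
  unfold torusSupNorm
  refine Finset.sup'_le _ _ fun μ _ => ?_
  have hrep : ((((y μ).val : ℤ) - ((y₁ μ).val : ℤ) : ℤ) : ZMod (levM k N L j)) = (y - y₁) μ := by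
    rw [Int.cast_sub, Int.cast_natCast, Int.cast_natCast, ZMod.natCast_zmod_val, ZMod.natCast_zmod_val]
    rfl
  show ((circAbs (levM k N L j) (((y μ).val : ℤ) - ((y₁ μ).val : ℤ)) : ℤ) : ℝ) ≤ _
  have h1 : ((circAbs (levM k N L j) (((y μ).val : ℤ) - ((y₁ μ).val : ℤ)) : ℤ) : ℝ) ≤ (pabs ((y - y₁) μ) : ℝ) := by
    have := circAbs_le_pabs (T := levM k N L j) (((y μ).val : ℤ) - ((y₁ μ).val : ℤ))
    rw [hrep] at this
    exact Int.cast_le.mpr this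
  exact h1.trans (Finset.single_le_sum (f := fun μ => (pabs ((y - y₁) μ) : ℝ))
    (fun ν _ => by exact_mod_cast pabs_nonneg _) (Finset.mem_univ μ))

/-! ## §3 The transported per-block bound: (1.110), second entry, at `U = 1`, block row sums uniform in the spacing -/

/-- **(1.110), SECOND ENTRY `∇G`, `U = 1`, `a = 1`, PER-BLOCK ROW SUMS, n-UNIFORM** — transported from the NE3 lineage's
`SliceFlatGradient.cubeSum_rowDiff_gFlat_le` (any constants `B₁`, `δ ≥ 0` satisfying its row statement): on Bałaban's fine torus
`Tor (fine (side k L j) (Mlev d k N L j))` (`n = L^j` sites per block side, `N·L^{k−j}` blocks per direction, `j ≤ k`), for every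
direction `ν`, every row `i` and every block `y′`,
`Σ_{x′ : blockOf x′ = y′} ‖(∇_ν·Δ_1⁻¹)(i,x′)‖ ≤ B₁·e^{−δ·|blockOf(i) − y′|_{T₁,∞}}`.
(Location of the printed text: [B5] `Balaban1984PropagatorsI` p. 35, (1.110), second entry; the typed inequality, with unit cubes, the
ℓ^∞ block distance and NE3's constants, is not a quotation.) [folklore] -/
theorem block_row_sum_fdiff_inv_le {B₁ δ : ℝ} (hδ : 0 ≤ δ)
    (hrow : ∀ (k N L : ℕ) [NeZero N] [NeZero L] (j : ℕ), j ≤ k →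
      ∀ (ν : Fin (d + 1)) (p : TPt (d + 1) (N * L ^ k) × Fin (d + 1)) (y₁ : TPt (d + 1) (levM k N L j)),
        ∑ q ∈ Finset.univ.filter (fun q => cubeI (d + 1) k N L (Fin (d + 1)) j q = y₁),
            |rowDiff d k N L ν (gFlat d k N L j) p q|
          ≤ B₁ * (L : ℝ) ^ j * Real.exp (-(δ * nbd (d + 1) k N L j (cubeI (d + 1) k N L (Fin (d + 1)) j p) y₁)))
    {j : ℕ} (hj : j ≤ k) (ν : Fin (d + 1)) (i : Tor (fine (side k L j) (Mlev d k N L j)) × Fin (d + 1))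
    (y' : TPt (d + 1) (levM k N L j)) :
    ∑ x' : Tor (fine (side k L j) (Mlev d k N L j)) × Fin (d + 1),
        (if blockOf (side k L j) (Mlev d k N L j) x'.1 = y' then
          ‖(fdiff (fine (side k L j) (Mlev d k N L j)) (side k L j : ℂ) ν * (DeltaA (side k L j) (Mlev d k N L j) 1)⁻¹) i x'‖
         else 0)
      ≤ B₁ * Real.exp (-(δ * torusSupNorm (Mlev d k N L j)
          (rep (Mlev d k N L j) (blockOf (side k L j) (Mlev d k N L j) i.1) - rep (Mlev d k N L j) y'))) := by
  have hn0 : (0 : ℝ) < (side k L j : ℝ) := by exact_mod_cast one_le_side k L j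
  have hside : ((side k L j : ℕ) : ℝ) = (L : ℝ) ^ j := by
    rw [side, min_eq_left hj, Nat.cast_pow]
  -- the row, pulled back along `eF`
  obtain ⟨p, rfl⟩ : ∃ p : TPt (d + 1) (N * L ^ k) × Fin (d + 1), i = (eF d k N L j p.1, p.2) :=
    ⟨((eF d k N L j).symm i.1, i.2), by simp⟩
  set G := fdiff (fine (side k L j) (Mlev d k N L j)) (side k L j : ℂ) ν * (DeltaA (side k L j) (Mlev d k N L j) 1)⁻¹
    with hG
  have hblk : blockOf (side k L j) (Mlev d k N L j) (eF d k N L j p.1, p.2).1 = cubeI (d + 1) k N L (Fin (d + 1)) j p :=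
    blockOf_eF d k N L j p.1
  -- NE3's constant is nonnegative (its row statement at this very instance)
  have hB : 0 ≤ B₁ := by
    have h := (Finset.sum_nonneg fun q _ => abs_nonneg _).trans (hrow k N L j hj ν p y')
    have hL : (0 : ℝ) < (L : ℝ) := by exact_mod_cast Nat.pos_of_ne_zero (NeZero.ne L)
    have hpos : 0 < (L : ℝ) ^ j * Real.exp (-(δ * nbd (d + 1) k N L j (cubeI (d + 1) k N L (Fin (d + 1)) j p) y')) := by
      positivity
    rw [mul_assoc] at h
    exact (mul_nonneg_iff_of_pos_right hpos).mp h
  -- (1) reindex the block sum along `eF × id`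
  have step1 : ∑ x' : Tor (fine (side k L j) (Mlev d k N L j)) × Fin (d + 1),
        (if blockOf (side k L j) (Mlev d k N L j) x'.1 = y' then ‖G (eF d k N L j p.1, p.2) x'‖ else 0)
      = ∑ q : TPt (d + 1) (N * L ^ k) × Fin (d + 1),
        (if cubeI (d + 1) k N L (Fin (d + 1)) j q = y' then ‖G (eF d k N L j p.1, p.2) (eF d k N L j q.1, q.2)‖ else 0) := by
    refine (Fintype.sum_equiv ((eF d k N L j).prodCongr (Equiv.refl _)) _ _ fun q => ?_).symm
    obtain ⟨z, μ⟩ := q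
    simp only [Equiv.prodCongr_apply, Equiv.coe_refl, Prod.map_apply, id_eq]
    rw [blockOf_eF]
    rfl
  -- (2) the summands are NE3's row differences divided by `n = L^{min(j,k)}`
  have step2 : ∑ q : TPt (d + 1) (N * L ^ k) × Fin (d + 1),
        (if cubeI (d + 1) k N L (Fin (d + 1)) j q = y' then ‖G (eF d k N L j p.1, p.2) (eF d k N L j q.1, q.2)‖ else 0)
      = ((side k L j : ℕ) : ℝ)⁻¹ * ∑ q ∈ Finset.univ.filter (fun q => cubeI (d + 1) k N L (Fin (d + 1)) j q = y'),
          |rowDiff d k N L ν (gFlat d k N L j) p q| := by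
    rw [Finset.sum_filter, Finset.mul_sum]
    refine Finset.sum_congr rfl fun q _ => ?_
    split_ifs
    · rw [abs_rowDiff_gFlat_eq, ← hG, ← mul_assoc, inv_mul_cancel₀ hn0.ne', one_mul]
    · rw [mul_zero]
  -- (3) NE3's bound, `n = L^j`, and the distance dictionary
  rw [step1, step2]
  have h3 := hrow k N L j hj ν p y'
  have hT := torusSupNorm_rep_sub_rep_le_nbd d k N L j (cubeI (d + 1) k N L (Fin (d + 1)) j p) y'
  calc ((side k L j : ℕ) : ℝ)⁻¹ * ∑ q ∈ Finset.univ.filter (fun q => cubeI (d + 1) k N L (Fin (d + 1)) j q = y'),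
          |rowDiff d k N L ν (gFlat d k N L j) p q|
      ≤ ((side k L j : ℕ) : ℝ)⁻¹ * (B₁ * (L : ℝ) ^ j
          * Real.exp (-(δ * nbd (d + 1) k N L j (cubeI (d + 1) k N L (Fin (d + 1)) j p) y'))) :=
        mul_le_mul_of_nonneg_left h3 (inv_nonneg.mpr hn0.le)
    _ = B₁ * Real.exp (-(δ * nbd (d + 1) k N L j (cubeI (d + 1) k N L (Fin (d + 1)) j p) y')) := by
        rw [← hside, mul_assoc, mul_left_comm (((side k L j : ℕ) : ℝ)⁻¹), inv_mul_cancel_left₀ hn0.ne']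
    _ ≤ B₁ * Real.exp (-(δ * torusSupNorm (Mlev d k N L j)
          (rep (Mlev d k N L j) (blockOf (side k L j) (Mlev d k N L j) (eF d k N L j p.1, p.2).1)
            - rep (Mlev d k N L j) y'))) := by
        rw [hblk]
        exact mul_le_mul_of_nonneg_left (Real.exp_le_exp.mpr (neg_le_neg (mul_le_mul_of_nonneg_left hT hδ))) hB

/-! ## §4 Exponentially weighted row sums, uniform in the spacing and in the volume -/

/-- **(1.110), SECOND ENTRY `∇G`, `U = 1`, `a = 1`, WEIGHTED ROW SUMS, n-UNIFORM** — for `δ′ < δ`, every direction `ν` and every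
row `i` of Bałaban's fine torus over the cubic unit torus with `N·L^{k−j}` blocks per direction (`j ≤ k`, `L^j` sites per block side):
`Σ_{x′} e^{δ′·|blockOf(i) − blockOf(x′)|_{T₁,∞}}·‖(∇_ν·Δ_1⁻¹)(i,x′)‖ ≤ B₁·K_{d+1}(δ − δ′)`, `K = latticeConst` — the exponentially
weighted `ℓ^∞ → ℓ^∞` norm of `∇_νG`, bounded by a function of `d`, `δ′` and NE3's constants alone (pv15's block swap and uniform torus
sum, the §3 pattern of `B5G110BlockRowSum.weighted_row_sum_le`). [folklore] -/
theorem weighted_row_sum_fdiff_inv_le {B₁ δ : ℝ} (hδ : 0 ≤ δ)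
    (hrow : ∀ (k N L : ℕ) [NeZero N] [NeZero L] (j : ℕ), j ≤ k →
      ∀ (ν : Fin (d + 1)) (p : TPt (d + 1) (N * L ^ k) × Fin (d + 1)) (y₁ : TPt (d + 1) (levM k N L j)),
        ∑ q ∈ Finset.univ.filter (fun q => cubeI (d + 1) k N L (Fin (d + 1)) j q = y₁),
            |rowDiff d k N L ν (gFlat d k N L j) p q|
          ≤ B₁ * (L : ℝ) ^ j * Real.exp (-(δ * nbd (d + 1) k N L j (cubeI (d + 1) k N L (Fin (d + 1)) j p) y₁)))
    {j : ℕ} (hj : j ≤ k) {δ' : ℝ} (hδ' : δ' < δ) (ν : Fin (d + 1))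
    (i : Tor (fine (side k L j) (Mlev d k N L j)) × Fin (d + 1)) :
    ∑ x' : Tor (fine (side k L j) (Mlev d k N L j)) × Fin (d + 1),
        Real.exp (δ' * torusSupNorm (Mlev d k N L j)
            (rep (Mlev d k N L j) (blockOf (side k L j) (Mlev d k N L j) i.1)
              - rep (Mlev d k N L j) (blockOf (side k L j) (Mlev d k N L j) x'.1)))
          * ‖(fdiff (fine (side k L j) (Mlev d k N L j)) (side k L j : ℂ) ν * (DeltaA (side k L j) (Mlev d k N L j) 1)⁻¹) i x'‖
      ≤ B₁ * latticeConst (d + 1) (δ - δ') := by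
  set G := fdiff (fine (side k L j) (Mlev d k N L j)) (side k L j : ℂ) ν * (DeltaA (side k L j) (Mlev d k N L j) 1)⁻¹
    with hG
  set y := blockOf (side k L j) (Mlev d k N L j) i.1 with hy
  -- block swap
  rw [sum_blockOf_mul (side k L j) (Mlev d k N L j)
    (fun y' => Real.exp (δ' * torusSupNorm (Mlev d k N L j) (rep (Mlev d k N L j) y - rep (Mlev d k N L j) y')))
    (fun x' => ‖G i x'‖)]
  -- per block: weight × decaying block row sum = decay at the reduced rate
  have hblock : ∀ y' : Tor (Mlev d k N L j),
      Real.exp (δ' * torusSupNorm (Mlev d k N L j) (rep (Mlev d k N L j) y - rep (Mlev d k N L j) y'))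
          * ∑ x', (if blockOf (side k L j) (Mlev d k N L j) x'.1 = y' then ‖G i x'‖ else 0)
        ≤ B₁ * Real.exp (-((δ - δ') * torusSupNorm (Mlev d k N L j) (rep (Mlev d k N L j) y - rep (Mlev d k N L j) y'))) := by
    intro y'
    have hb := block_row_sum_fdiff_inv_le d k N L hδ hrow hj ν i y'
    rw [← hG, ← hy] at hb
    set T := torusSupNorm (Mlev d k N L j) (rep (Mlev d k N L j) y - rep (Mlev d k N L j) y') with hT
    have hw : 0 ≤ Real.exp (δ' * T) := (Real.exp_pos _).le
    calc Real.exp (δ' * T) * ∑ x', (if blockOf (side k L j) (Mlev d k N L j) x'.1 = y' then ‖G i x'‖ else 0)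
        ≤ Real.exp (δ' * T) * (B₁ * Real.exp (-(δ * T))) := mul_le_mul_of_nonneg_left hb hw
      _ = B₁ * (Real.exp (δ' * T) * Real.exp (-(δ * T))) := by ring
      _ = B₁ * Real.exp (-((δ - δ') * T)) := by rw [← Real.exp_add]; ring_nf
  -- NE3's constant is nonnegative
  have hB : 0 ≤ B₁ := by
    have h0 : (0 : ℝ) ≤ ∑ x', (if blockOf (side k L j) (Mlev d k N L j) x'.1 = y then ‖G i x'‖ else 0) :=
      Finset.sum_nonneg fun x' _ => by split_ifs <;> simp
    have hb := block_row_sum_fdiff_inv_le d k N L hδ hrow hj ν i y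
    rw [← hG, ← hy] at hb
    have hpos : 0 < Real.exp (-(δ * torusSupNorm (Mlev d k N L j) (rep (Mlev d k N L j) y - rep (Mlev d k N L j) y))) :=
      Real.exp_pos _
    exact (mul_nonneg_iff_of_pos_right hpos).mp (h0.trans hb)
  -- the uniform torus sum at the reduced rate
  have hS : ∑ y' : Tor (Mlev d k N L j),
      Real.exp (-((δ - δ') * torusSupNorm (Mlev d k N L j) (rep (Mlev d k N L j) y - rep (Mlev d k N L j) y')))
      ≤ latticeConst (d + 1) (δ - δ') :=
    sum_exp_torusSupNorm_sub_rep_le (Mlev d k N L j) (sub_pos.mpr hδ') (rep (Mlev d k N L j) y)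
  calc ∑ y' : Tor (Mlev d k N L j),
        Real.exp (δ' * torusSupNorm (Mlev d k N L j) (rep (Mlev d k N L j) y - rep (Mlev d k N L j) y'))
          * ∑ x', (if blockOf (side k L j) (Mlev d k N L j) x'.1 = y' then ‖G i x'‖ else 0)
      ≤ ∑ y' : Tor (Mlev d k N L j),
        B₁ * Real.exp (-((δ - δ') * torusSupNorm (Mlev d k N L j) (rep (Mlev d k N L j) y - rep (Mlev d k N L j) y'))) :=
        Finset.sum_le_sum fun y' _ => hblock y'
    _ = B₁ * ∑ y' : Tor (Mlev d k N L j),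
        Real.exp (-((δ - δ') * torusSupNorm (Mlev d k N L j) (rep (Mlev d k N L j) y - rep (Mlev d k N L j) y'))) := by
        rw [Finset.mul_sum]
    _ ≤ B₁ * latticeConst (d + 1) (δ - δ') := mul_le_mul_of_nonneg_left hS hB

end Flat

/-! ## §5 The packaged form: every spacing `n⁻¹`, every CUBIC unit torus, constants depending on `d` only -/

/-- **(1.110), SECOND ENTRY `∇G` AT `U = 1` IN n-UNIFORM WEIGHTED ROW-SUM CURRENCY, PACKAGED**: there are `B, δ > 0` depending on the
dimension `d + 1` only (NE3's constants of `SliceFlatGradient.cubeSum_rowDiff_gFlat_le`) such that for EVERY number of sites per block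
side `n ≥ 1`, EVERY cubic unit torus `Π_μ ℤ/N₀` (`N₀ ≥ 1`), every rate `δ′ < δ`, every direction `ν` and every row `i`,
`Σ_{x′} e^{δ′·|blockOf(i) − blockOf(x′)|_{T₁,∞}}·‖(∇_ν·Δ_1⁻¹)(i,x′)‖ ≤ B·K_{d+1}(δ − δ′)` — the sibling of pv15's
`B5G110BlockRowSum.weighted_row_sum_le'` (first entry) for the second entry of (1.110), on cubic tori.  Witness of the NE3 parameters:
`(k, N, L, j) = (1, N₀, n, 1)`. [folklore] -/
theorem weighted_row_sum_fdiff_inv_le_cubic :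
    ∃ B δ : ℝ, 0 < B ∧ 0 < δ ∧ ∀ (n N₀ : ℕ) [NeZero n] [NeZero N₀] (δ' : ℝ), δ' < δ →
      ∀ (ν : Fin (d + 1)) (i : Tor (fine n (fun _ : Fin (d + 1) => N₀)) × Fin (d + 1)),
        ∑ x' : Tor (fine n (fun _ : Fin (d + 1) => N₀)) × Fin (d + 1),
            Real.exp (δ' * torusSupNorm (fun _ : Fin (d + 1) => N₀)
                (rep (fun _ : Fin (d + 1) => N₀) (blockOf n (fun _ : Fin (d + 1) => N₀) i.1)
                  - rep (fun _ : Fin (d + 1) => N₀) (blockOf n (fun _ : Fin (d + 1) => N₀) x'.1)))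
              * ‖(fdiff (fine n (fun _ : Fin (d + 1) => N₀)) (n : ℂ) ν * (DeltaA n (fun _ : Fin (d + 1) => N₀) 1)⁻¹) i x'‖
          ≤ B * latticeConst (d + 1) (δ - δ') := by
  obtain ⟨B₁, δ, hB, hδ, hrow⟩ := cubeSum_rowDiff_gFlat_le d
  refine ⟨B₁, δ, hB, hδ, fun n N₀ _ _ δ' hδ' ν i => ?_⟩
  have key : ∀ (n' : ℕ) (M' : Fin (d + 1) → ℕ), n' = side 1 n 1 → M' = Mlev d 1 N₀ n 1 →
      ∀ [NeZero n'] [∀ μ, NeZero (M' μ)] (i : Tor (fine n' M') × Fin (d + 1)),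
        ∑ x' : Tor (fine n' M') × Fin (d + 1),
            Real.exp (δ' * torusSupNorm M' (rep M' (blockOf n' M' i.1) - rep M' (blockOf n' M' x'.1)))
              * ‖(fdiff (fine n' M') (n' : ℂ) ν * (DeltaA n' M' 1)⁻¹) i x'‖
          ≤ B₁ * latticeConst (d + 1) (δ - δ') := by
    intro n' M' hn' hM'
    subst hn' hM'
    intro _ _ i
    exact weighted_row_sum_fdiff_inv_le d 1 N₀ n hδ.le hrow le_rfl hδ' ν i
  exact key n (fun _ => N₀) (by simp [side]) (by funext μ; simp [Mlev, levM]) i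

end Summit.QuantumFields.BalabanUV.T4Continuum.GradientRowSumTransport

end
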